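import Literature.NumberTheory.Automorphic.KimExteriorSquareGL4
import Literature.NumberTheory.Automorphic.RamakrishnanTensorProductGL2
import HarnessLib

/-!
# Asgari–Raghuram: the cuspidality criterion for the exterior square transfer `∧² : GL₄ → GL₆`
# (named fact, the unconditional direction (i) ⇒ (iii) of Theorem 1.1, Satake form)

Topic `NumberTheory/Automorphic`; namespace `Literature.NumberTheory.Automorphic`.

Source: M. Asgari, A. Raghuram, *A cuspidality criterion for the exterior square transfer of cusp
forms on GL(4)*, in: On Certain L-Functions (Clay Math. Proc. 13, 2011) 33–53 = arXiv:0712.4315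
[AsgariRaghuram2007]; quotations from the held arXiv text (`paper:arxiv-0712.4315`, pp. 3–4 of the
materialised text = §1).

> **Theorem 1.1.** "Let `F` be a number field and let `Π` be a cuspidal automorphic representation
> of `GL(4, 𝔸_F)`. The following are equivalent:
> (i) `∧²Π` is not cuspidal.
> (ii) `Π` is one of the following: (a) `Π = π₁ ⊠ π₂` …; (b) `Π = As(π)`, the Asai transfer of a
> dihedral cuspidal automorphic representation `π` of `GL(2, 𝔸_E)` where `E/F` is a quadratic
> extension; (c) `Π` is the functorial transfer of a cuspidal representation `π` of `GSp(4, 𝔸_F)` …;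
> (d) `Π = I_E^F(π)`, the automorphic induction of a cuspidal automorphic representation `π` of
> `GL(2, 𝔸_E)`, where `E/F` is a quadratic extension.
> (iii) `Π` satisfies one of the following: (α) `Π ≅ Π̃ ⊗ χ` for some Hecke character `χ` of `F`,
> and `Π` is not the Asai transfer of a nondihedral cuspidal representation.
> (β) `Π ≅ Π ⊗ χ` for a nontrivial Hecke character `χ` of `F`."
> (§1: "The proof of (i) ⟹ (iii) … uses some details from the Langlands–Shahidi machinery. We show
> in Proposition 4.1 that if `Π` is not essentially self-dual, then `∧²Π` cannot have a degree 1 or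
> degree 3 isobaric summand. In Proposition 4.2 we verify that if `Π` does not admit a nontrivial
> self-twist, then `∧²Π` cannot have a degree 2 isobaric summand." — descent theory enters only
> (iii) ⟹ (ii).)

Here `∧²Π` is Kim's exterior square transfer (Kim 2003, Thm. A; the tree's named fact
`Kim2003_exteriorSquare_GL4`, file `KimExteriorSquareGL4`): the automorphic representation of
`GL(6, 𝔸_F)`, unique by the Jacquet–Shalika classification, whose local component at almost every
place has Satake parameter `{αᵢαⱼ : i < j} = wedgeTwoParams α` when `Π_v` has Satake parameter `α`.

## What is vendored and why it is implied by the printed theorem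

Only the direction **(i) ⟹ (iii)**, with the Asai exclusion in (α) DROPPED (a weakening of the
conclusion), at the level of Satake parameters almost everywhere — the form consumed by route
`Langlands/ExteriorSquareAscent` (item `InducedSquareAscent`, applied over the auxiliary quadratic
field).

* Hypothesis.  "(i) `∧²Π` is not cuspidal" is rendered by: *there is no cuspidal datum `Σ` on
  `GL₆(𝔸_F)` whose Satake parameter at almost every finite `v` is `wedgeTwoParams α` whenever `Π`
  has Satake parameter `α` at `v`.*  If `∧²Π` were cuspidal it would be such a `Σ` (its Borel–Jacquet
  datum on cusp forms, `CuspidalAutomorphicRepData 6`), so the rendered hypothesis implies (i); it is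
  in fact equivalent to (i) by strong multiplicity one for isobaric representations
  (Jacquet–Shalika 1981, Thm. 4.4), which is not folded in.
* Conclusion (α).  `Π ≅ Π̃ ⊗ χ` gives, at every finite `v` where `Π` and `χ` are unramified,
  `t_{Π,v} = χ(ϖ_v) · t_{Π,v}⁻¹` as multisets (`Π̃` has Satake parameter `α⁻¹`, Getz–Hahn 2024
  Prop. 7.6.2, tree `CuspidalAutomorphicRepData.exists_contragredient_satake`; the twist multiplies it
  by `χ(ϖ_v)`, tree `AutomorphicRepData.eventually_hasSatakeParamAt_twist`), i.e. `Π` has Satake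
  parameter `α.map (χ(ϖ_v) * ·⁻¹)` at `v` whenever it has `α` — rendered with the tree's
  `HeckeCharacter.valueAtUniformizer` exactly as `IsSatakeTwistBy` (file `RamakrishnanTensorProductGL2`).
* Conclusion (β).  `Π ≅ Π ⊗ χ`, `χ ≠ 1`, is the tree's `IsSatakeSelfTwist Π.1`
  (`∃ δ : HeckeCharacter F, δ ≠ 1 ∧ IsSatakeTwistBy Π.1 Π.1 δ`, same file).
* `hF m` is the tree's standing fact `isCompact_glFiniteIntegralLevel m F` (parameter of the `GL_m`
  automorphy datum), as in `Kim2003_exteriorSquare_GL4`.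

Nothing is strengthened: hypothesis ⟹ printed (i), printed (iii) ⟹ conclusion.  The self-twisting
character in (β) has order dividing `4` (`ω_Π = ω_Π χ⁴`); this consequence is NOT folded in.

## References

* M. Asgari, A. Raghuram, arXiv:0712.4315 = Clay Math. Proc. 13 (2011) 33–53, Thm. 1.1,
  Props. 4.1–4.2. [AsgariRaghuram2007]
* H. H. Kim, J. Amer. Math. Soc. 16 (2003) 139–183, Thm. A. [Kim2002]
* H. Jacquet, J. Shalika, Amer. J. Math. 103 (1981), Thm. 4.4. [JacquetShalikaAJM1981II]
-/

noncomputable section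

open scoped Classical MatrixGroups
open IsDedekindDomain NumberField

namespace Literature.NumberTheory.Automorphic

/-- **Asgari–Raghuram 2007/2011, Theorem 1.1, direction (i) ⟹ (iii) (cuspidality criterion for
`∧² : GL₄ → GL₆`, Satake form, Asai exclusion dropped).**  Let `F` be a number field and `Π` a
cuspidal automorphic representation of `GL₄(𝔸_F)`.  If `∧²Π` is not cuspidal — rendered: no cuspidal
datum `Σ` on `GL₆(𝔸_F)` has Satake parameter `wedgeTwoParams α = {αᵢαⱼ : i < j}` at almost every
finite `v` where `Π` has Satake parameter `α` — then either (α) `Π ≅ Π̃ ⊗ χ` for some Hecke character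
`χ` of `F`, rendered on Satake parameters: for almost all `v`, `Π` has parameter
`{χ(ϖ_v) αᵢ⁻¹}` at `v` whenever it has `{αᵢ}`; or (β) `Π ≅ Π ⊗ χ` for a nontrivial Hecke character
`χ` (`IsSatakeSelfTwist`).  Grounds `Summit.Langlands.Langlands.Theses.ExteriorSquareAscent.InducedSquareAscent`
(applied to the base change of `π` to the quadratic field).
[cite: AsgariRaghuram2007, Thm. 1.1 (i) ⟹ (iii) and Props. 4.1–4.2] -/
def AsgariRaghuram_wedgeTwo_notCuspidal_GL4 : Prop :=
  ∀ (F : Type) [Field F] [NumberField F] (hF : ∀ m : ℕ, isCompact_glFiniteIntegralLevel m F)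
    (π : CuspidalAutomorphicRepData 4 F (hF 4)),
    (¬ ∃ S : CuspidalAutomorphicRepData 6 F (hF 6),
        ∀ᶠ v : HeightOneSpectrum (𝓞 F) in Filter.cofinite, ∀ α : Multiset ℂ,
          π.1.HasSatakeParamAt v α → S.1.HasSatakeParamAt v (wedgeTwoParams α)) →
    (∃ χ : GaloisRepresentations.HeckeCharacter F,
        ∀ᶠ v : HeightOneSpectrum (𝓞 F) in Filter.cofinite, ∀ α : Multiset ℂ,
          π.1.HasSatakeParamAt v α →
            π.1.HasSatakeParamAt v (α.map fun z ↦ χ.valueAtUniformizer v * z⁻¹)) ∨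
    IsSatakeSelfTwist π.1

end Literature.NumberTheory.Automorphic

end
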